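import Literature.Analysis.FluidPDE.TypeIRateScaledEnergyBoundUniform
import Literature.Analysis.FluidPDE.SpaceTimeRescaling
import Literature.Analysis.FluidPDE.SuitableWeakRescaling
import Literature.Analysis.FluidPDE.SereginSverakPressureProofs
import Literature.Analysis.FluidPDE.ClassicalSuitable
import Summits.NavierStokesRegularity.NavierStokesRegularity.Theorems.StretchingWellBindingEnstrophyQuarterLawDissipationQuantum
import Summits.NavierStokesRegularity.NavierStokesRegularity.Theorems.TypeIQuarterGateQuarterLawTypeIOneScaleTools
import Summits.NavierStokesRegularity.NavierStokesRegularity.Theorems.HalfHolderEnergyHolderBridge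
import Summits.NavierStokesRegularity.NavierStokesRegularity.Theorems.LerayQuarterDissipationFiniteDissipationLiouvilleSliceHolder
import HarnessLib

/-!
# `TypeIQuarterGate.QuarterLawTypeI` (crux stmt-NavierStokesRegularity-23726), line `lorentz-upgrade`,
# stub `stub_countQuarterLaw` (= item 23971 `CountQuarterLaw`) — ONE-SCALE SMALLNESS under the
# sup-norm Type-I rate

Helper file (`--supports stmt-NavierStokesRegularity-23726`): the analytic input named by the reduction
`CountQuarterLaw.stub_countQuarterLaw_of_oneScale` (`TypeIQuarterGateQuarterLawTypeICountReduction`).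
For a classical Leray–Hopf solution on `[0,T)` (viscosity `ν`) with the sup-norm Type-I rate at `T` and
every `μ > 0` there are `η, λ > 0`, `t₀ < T` such that for `t ∈ (t₀,T)` every `x` whose vertex-`T`
cylinder `B_r(x) × (T−r², T)`, `r = λ√(T−t)`, is NOT `η`-concentrating (`∫∫ |∇u|_F² < η r`) has
`‖u(t,x)‖ ≤ μ/√(T−t)`.

PROOF: unit-viscosity rescaling with Tao's pressure gauge; at the apex `(νT, x)` the Type-I rate and the
slab integrals `∫∫|u|³`, `∫∫|q|^{3/2}` bound `A + E + C + D ≤ K` on `Q_ϱ(νT,x)`, `ϱ < r₁/2`, uniformly in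
`x` (`scaledEnergies_bounded_of_typeIRate_unif`); the dissipation quantum (`DissipationQuantum.small_of_cknE_le
K 1`) turns `E(ϱ) ≤ η` (non-concentration at the physical scale `r = ϱ/κ`, `κ = min(1,√ν)`) into
`|v| ≤ 1/(ϑϱ)` a.e. on `Q_{ϑϱ/2}`; un-zoom, a.e. → pointwise by continuity, `λ` large.

HONEST FRAMING: known ε-regularity bookkeeping (CKN 1982 / Seregin 2006–2014 / Seregin–Šverák 2009)
along a HYPOTHETICAL Type-I blow-up; nothing about Navier–Stokes regularity or blow-up is claimed, and no
stub is closed by this file alone. [cite: Seregin2014, Ch. 6 §6.3 Prop. 3.11 (i)]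
[cite: CaffarelliKohnNirenberg1982, Proposition 1]
-/

-- the problem directory repeats the summit name (`NavierStokesRegularity/NavierStokesRegularity`)
set_option linter.dupNamespace false

noncomputable section

open Set Filter MeasureTheory Topology Metric Function
open scoped ENNReal NNReal

namespace Summit.NavierStokesRegularity.NavierStokesRegularity.Theorems

namespace CountQuarterLaw

open Literature.Analysis.FluidPDE

variable {ν T : ℝ} {u : ℝ → EuclideanSpace ℝ (Fin 3) → EuclideanSpace ℝ (Fin 3)}
  {p : ℝ → EuclideanSpace ℝ (Fin 3) → ℝ}

/-- **One-scale smallness under the sup-norm Type-I rate.** For a classical solution on `[0,T)`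
(viscosity `ν > 0`), Leray–Hopf on `[0,T]`, with `IsTypeIBlowup u T`: for every `μ > 0` there are
`η, λ > 0`, `t₀ < T` such that for `t ∈ (t₀, T)` and all `x`, if the vertex-`T` cylinder of radius
`r = λ√(T−t)` around `x` is not `η`-concentrating then `‖u(t,x)‖ ≤ μ/√(T−t)`.
[cite: Seregin2014, Ch. 6 §6.3 Prop. 3.11 (i)] [cite: CaffarelliKohnNirenberg1982, Proposition 1] -/
theorem oneScaleSmallness (hν : 0 < ν) (hT : 0 < T)
    (hsol : IsClassicalNSSolutionOn (Ico 0 T) ν 0 u p) (hLH : IsLerayHopfOn T ν 0 (u 0) u)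
    (hI : IsTypeIBlowup u T) :
    ∀ μ : ℝ, 0 < μ → ∃ η lam t₀ : ℝ, 0 < η ∧ 0 < lam ∧ t₀ < T ∧
      ∀ t ∈ Ioo t₀ T, ∀ x : EuclideanSpace ℝ (Fin 3),
        ¬ (ENNReal.ofReal (η * (lam * Real.sqrt (T - t))) ≤
            ∫⁻ s in Ioo (T - (lam * Real.sqrt (T - t)) ^ 2) T,
              ∫⁻ y in ball x (lam * Real.sqrt (T - t)),
                ENNReal.ofReal (frobeniusNormSq (fderiv ℝ (u s) y))) →
        ‖u t x‖ ≤ μ / Real.sqrt (T - t) := by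
  intro μ hμ
  set α : ℝ := ν⁻¹ with hα
  have hαpos : 0 < α := inv_pos.2 hν
  have hαν : α * ν = 1 := by rw [hα, inv_mul_cancel₀ hν.ne']
  have hνα : ν * α = 1 := by rw [mul_comm, hαν]
  have hβeq : α = α * 1 := (mul_one α).symm
  set Sl : TopologicalSpace.Opens (ℝ × EuclideanSpace ℝ (Fin 3)) :=
    ⟨Ioo 0 T ×ˢ univ, isOpen_Ioo.prod isOpen_univ⟩ with hSldef
  have hSlsub : (Sl : Set (ℝ × EuclideanSpace ℝ (Fin 3))) ⊆ Ioo 0 T ×ˢ univ := Subset.rfl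
  set q : ℝ → EuclideanSpace ℝ (Fin 3) → ℝ := fun t x => p t x - (p t 0 - normalisedPressure (u t) 0)
    with hq
  set v : ℝ → EuclideanSpace ℝ (Fin 3) → EuclideanSpace ℝ (Fin 3) := α • stPull α 1 0 0 u with hv
  set Gv : ℝ → EuclideanSpace ℝ (Fin 3) → EuclideanSpace ℝ (Fin 3) →L[ℝ] EuclideanSpace ℝ (Fin 3) :=
    (α * 1) • stPull α 1 0 0 fun t x => fderiv ℝ (u t) x with hGv_def
  have hsw : IsSuitableWeakSolutionOn (stPreimage α 1 0 0 Sl) 1 0 v (α ^ 2 • stPull α 1 0 0 q) := by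
    have h0 := (SereginSverak2002.isSuitableWeakSolutionOn_gauge_of_classical hν hT hsol hLH Sl
      hSlsub).stRescale hαpos one_pos hβeq 0 0
    have hvisc : α * ν / 1 = 1 := by rw [div_one, hαν]
    have hforce : ((α ^ 2 * 1) • stPull α 1 0 0 (0 : ℝ → EuclideanSpace ℝ (Fin 3) →
        EuclideanSpace ℝ (Fin 3))) = 0 := by
      funext s y; simp [stPull]
    rw [hvisc, hforce] at h0
    exact h0
  have hGv : HasWeakSpatialGradientOn (stPreimage α 1 0 0 Sl) v Gv :=
    (hasWeakSpatialGradientOn_of_contDiffOn isOpen_Ioo hSlsub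
      ((SereginSverak2002.classical_Ioo hsol).smooth_velocity.of_le (by norm_cast))).stRescale
      α hαpos one_pos 0 0
  have hcyl : ∀ (τ ρ : ℝ) (x : EuclideanSpace ℝ (Fin 3)), ρ ^ 2 ≤ τ → τ ≤ ν * T →
      parabolicCylinder ρ ((τ, x) : ℝ × EuclideanSpace ℝ (Fin 3)) ⊆
        ((stPreimage α 1 0 0 Sl : TopologicalSpace.Opens (ℝ × EuclideanSpace ℝ (Fin 3))) :
          Set (ℝ × EuclideanSpace ℝ (Fin 3))) := by
    intro τ ρ x hρτ hτT w hw
    rw [mem_parabolicCylinder] at hw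
    change stAffine α 1 0 0 w ∈ Ioo 0 T ×ˢ (univ : Set (EuclideanSpace ℝ (Fin 3)))
    rw [mem_prod, stAffine_fst]
    have hw1 : 0 < w.1 := by nlinarith [hw.1.1, sq_nonneg ρ]
    have hw2 : α * w.1 < α * (ν * T) := mul_lt_mul_of_pos_left (lt_of_lt_of_le hw.1.2 hτT) hαpos
    have e : α * (ν * T) = T := by rw [← mul_assoc, hαν, one_mul]
    refine ⟨⟨by nlinarith [mul_pos hαpos hw1], by linarith⟩, mem_univ _⟩
  have hανT : α * (ν * T) = T := by rw [← mul_assoc, hαν, one_mul]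
  have hpre : ∀ (r : ℝ) (x : EuclideanSpace ℝ (Fin 3)),
      stAffine α 1 0 0 ⁻¹' (Ioo (α * (ν * T - r ^ 2)) (α * (ν * T)) ×ˢ ball x r) =
        parabolicCylinder r ((ν * T, x) : ℝ × EuclideanSpace ℝ (Fin 3)) := by
    intro r x
    ext w
    simp only [mem_preimage, mem_prod, stAffine_fst, stAffine_snd, mem_parabolicCylinder, mem_Ioo,
      mem_ball, zero_add, one_smul]
    constructor
    · rintro ⟨⟨h1, h2⟩, h3⟩
      exact ⟨⟨lt_of_mul_lt_mul_left h1 hαpos.le, lt_of_mul_lt_mul_left h2 hαpos.le⟩, h3⟩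
    · rintro ⟨⟨h1, h2⟩, h3⟩
      exact ⟨⟨mul_lt_mul_of_pos_left h1 hαpos, mul_lt_mul_of_pos_left h2 hαpos⟩, h3⟩
  obtain ⟨CI, hCI⟩ := hI
  obtain ⟨tI, htIT, hIsub⟩ := mem_nhdsLT_iff_exists_Ioo_subset.1 hCI
  set tI' : ℝ := max tI 0 with htI'
  have htI'T : tI' < T := max_lt htIT hT
  have htI'0 : 0 ≤ tI' := le_max_right _ _
  set B : ℝ := max CI 0 with hB
  have hB0 : 0 ≤ B := le_max_right _ _
  have hrate : ∀ s ∈ Ioo tI' T, ∀ y, ‖u s y‖ ≤ B / Real.sqrt (T - s) := fun s hs y =>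
    (hIsub ⟨lt_of_le_of_lt (le_max_left _ _) hs.1, hs.2⟩ y).trans
      (div_le_div_of_nonneg_right (le_max_left _ _) (Real.sqrt_nonneg _))
  set r₁ : ℝ := Real.sqrt (ν * (T - tI')) / 2 with hr₁
  have hνTI : 0 < ν * (T - tI') := mul_pos hν (by linarith)
  have hr₁pos : 0 < r₁ := by rw [hr₁]; exact div_pos (Real.sqrt_pos.2 hνTI) two_pos
  have hr₁sq : r₁ ^ 2 = ν * (T - tI') / 4 := by
    rw [hr₁, div_pow, Real.sq_sqrt hνTI.le]; norm_num
  have hr₁T : r₁ ^ 2 ≤ ν * T := by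
    rw [hr₁sq]
    have : ν * (T - tI') ≤ ν * T := mul_le_mul_of_nonneg_left (by linarith) hν.le
    linarith [hνTI]
  have hαr₁ : α * r₁ ^ 2 ≤ T - tI' := by
    rw [hr₁sq]
    have : α * (ν * (T - tI') / 4) = (T - tI') / 4 := by
      rw [mul_div_assoc', ← mul_assoc, hαν, one_mul]
    rw [this]; linarith
  have hαr₁T : α * r₁ ^ 2 ≤ T := by linarith
  have hI₃top : ∫⁻ w in Ioo 0 T ×ˢ (univ : Set (EuclideanSpace ℝ (Fin 3))), ‖u w.1 w.2‖ₑ ^ (3 : ℕ) < ⊤ :=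
    SereginSverak2002.lintegral_slab_enorm_pow_three_lt_top hν hLH
  have hPqtop : ∫⁻ w in Ioo 0 T ×ˢ (univ : Set (EuclideanSpace ℝ (Fin 3))),
      ‖q w.1 w.2‖ₑ ^ (3 / 2 : ℝ) < ⊤ :=
    SereginSverak2002.lintegral_slab_gauged_pressure_lt_top hν hT hsol hLH
  set C₃ : ℝ≥0∞ := ‖α‖ₑ ^ (3 : ℕ) *
      ENNReal.ofReal (α * (1 : ℝ) ^ Module.finrank ℝ (EuclideanSpace ℝ (Fin 3)))⁻¹ *
      ∫⁻ w in Ioo 0 T ×ˢ (univ : Set (EuclideanSpace ℝ (Fin 3))), ‖u w.1 w.2‖ₑ ^ (3 : ℕ) with hC₃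
  set P₃ : ℝ≥0∞ := ‖α ^ 2‖ₑ ^ (3 / 2 : ℝ) *
      ENNReal.ofReal (α * (1 : ℝ) ^ Module.finrank ℝ (EuclideanSpace ℝ (Fin 3)))⁻¹ *
      ∫⁻ w in Ioo 0 T ×ˢ (univ : Set (EuclideanSpace ℝ (Fin 3))), ‖q w.1 w.2‖ₑ ^ (3 / 2 : ℝ) with hP₃
  set C₀e : ℝ≥0∞ := (ENNReal.ofReal r₁ ^ 2)⁻¹ * C₃ with hC₀e
  set D₀e : ℝ≥0∞ := (ENNReal.ofReal r₁ ^ 2)⁻¹ * P₃ with hD₀e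
  have hr₁0 : ENNReal.ofReal r₁ ≠ 0 := (ENNReal.ofReal_pos.2 hr₁pos).ne'
  have hC₀top : C₀e ≠ ⊤ :=
    ENNReal.mul_ne_top (ENNReal.inv_ne_top.2 (pow_ne_zero _ hr₁0))
      (ENNReal.mul_ne_top (ENNReal.mul_ne_top (by simp) ENNReal.ofReal_ne_top) hI₃top.ne)
  have hD₀top : D₀e ≠ ⊤ :=
    ENNReal.mul_ne_top (ENNReal.inv_ne_top.2 (pow_ne_zero _ hr₁0))
      (ENNReal.mul_ne_top (ENNReal.mul_ne_top
        (ENNReal.rpow_ne_top_of_nonneg (by norm_num) enorm_ne_top) ENNReal.ofReal_ne_top) hPqtop.ne)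
  set c : ℝ := α * Real.sqrt ν * B with hc
  obtain ⟨K, hK⟩ := scaledEnergies_bounded_of_typeIRate_unif c C₀e.toNNReal D₀e.toNNReal
  obtain ⟨η, ϑ, hη, hϑ, hϑ1, Hq⟩ := EnstrophyQuarterLaw.DissipationQuantum.small_of_cknE_le K one_pos
  have hzsub : ∀ x : EuclideanSpace ℝ (Fin 3),
      parabolicCylinder r₁ ((ν * T, x) : ℝ × EuclideanSpace ℝ (Fin 3)) ⊆
        ((stPreimage α 1 0 0 Sl : TopologicalSpace.Opens (ℝ × EuclideanSpace ℝ (Fin 3))) :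
          Set (ℝ × EuclideanSpace ℝ (Fin 3))) := fun x => hcyl _ _ x hr₁T le_rfl
  have hCtop : ∀ x : EuclideanSpace ℝ (Fin 3),
      cknC r₁ ((ν * T, x) : ℝ × EuclideanSpace ℝ (Fin 3)) v ≤ C₀e := by
    intro x
    unfold cknC
    refine mul_le_mul' le_rfl ?_
    calc ∫⁻ w in parabolicCylinder r₁ ((ν * T, x) : ℝ × EuclideanSpace ℝ (Fin 3)), ‖v w.1 w.2‖ₑ ^ (3 : ℕ)
        ≤ ∫⁻ w in stAffine α 1 0 0 ⁻¹' (Ioo 0 T ×ˢ (univ : Set (EuclideanSpace ℝ (Fin 3)))),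
            ‖(α • stPull α 1 0 0 u) w.1 w.2‖ₑ ^ (3 : ℕ) := lintegral_mono_set (hzsub x)
      _ = C₃ := by rw [hC₃, setLIntegral_enorm_pow_stRescale hαpos one_pos 0 0 α u _ 3]
  have hDtop : ∀ x : EuclideanSpace ℝ (Fin 3),
      cknD r₁ ((ν * T, x) : ℝ × EuclideanSpace ℝ (Fin 3)) (α ^ 2 • stPull α 1 0 0 q) ≤ D₀e := by
    intro x
    unfold cknD
    refine mul_le_mul' le_rfl ?_
    calc ∫⁻ w in parabolicCylinder r₁ ((ν * T, x) : ℝ × EuclideanSpace ℝ (Fin 3)),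
          ‖(α ^ 2 • stPull α 1 0 0 q) w.1 w.2‖ₑ ^ (3 / 2 : ℝ)
        ≤ ∫⁻ w in stAffine α 1 0 0 ⁻¹' (Ioo 0 T ×ˢ (univ : Set (EuclideanSpace ℝ (Fin 3)))),
            ‖(α ^ 2 • stPull α 1 0 0 q) w.1 w.2‖ₑ ^ (3 / 2 : ℝ) := lintegral_mono_set (hzsub x)
      _ = P₃ := by rw [hP₃, setLIntegral_enorm_rpow_stRescale hαpos one_pos 0 0 (α ^ 2) q _ (by norm_num)]
  have hrateV : ∀ x : EuclideanSpace ℝ (Fin 3),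
      ∀ᵐ w ∂(volume.restrict (parabolicCylinder r₁ ((ν * T, x) : ℝ × EuclideanSpace ℝ (Fin 3)))),
        Real.sqrt (((ν * T, x) : ℝ × EuclideanSpace ℝ (Fin 3)).1 - w.1) * ‖v w.1 w.2‖ ≤ c := by
    intro x
    refine (ae_restrict_iff' (isOpen_parabolicCylinder _ _).measurableSet).2 (ae_of_all _ ?_)
    intro w hw
    rw [mem_parabolicCylinder] at hw
    obtain ⟨⟨hw1, hw2⟩, -⟩ := hw
    dsimp only at hw1 hw2 ⊢
    have ht'T : α * w.1 < T := by
      have h1 : α * w.1 < α * (ν * T) := mul_lt_mul_of_pos_left hw2 hαpos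
      rwa [← mul_assoc, hαν, one_mul] at h1
    have ht'I : tI' < α * w.1 := by
      have h1 : α * (ν * T - r₁ ^ 2) < α * w.1 := mul_lt_mul_of_pos_left hw1 hαpos
      have e : α * (ν * T - r₁ ^ 2) = T - α * r₁ ^ 2 := by
        rw [mul_sub, ← mul_assoc, hαν, one_mul]
      rw [e] at h1
      linarith
    have hTt' : 0 < T - α * w.1 := by linarith
    have hu := hrate (α * w.1) ⟨ht'I, ht'T⟩ (0 + (1 : ℝ) • w.2)
    have ev : v w.1 w.2 = α • u (0 + α * w.1) (0 + (1 : ℝ) • w.2) := smul_stPull_apply α α 1 0 0 u _ _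
    rw [zero_add] at ev
    rw [ev, norm_smul, Real.norm_of_nonneg hαpos.le]
    have e2 : ν * T - w.1 = ν * (T - α * w.1) := by rw [mul_sub, ← mul_assoc, hνα, one_mul]
    rw [e2, Real.sqrt_mul hν.le]
    have hs0 : 0 < Real.sqrt (T - α * w.1) := Real.sqrt_pos.2 hTt'
    have hu' : Real.sqrt (T - α * w.1) * ‖u (α * w.1) (0 + (1 : ℝ) • w.2)‖ ≤ B := by
      have := mul_le_mul_of_nonneg_left hu hs0.le
      rwa [mul_div_cancel₀ _ hs0.ne'] at this
    calc Real.sqrt ν * Real.sqrt (T - α * w.1) * (α * ‖u (α * w.1) (0 + (1 : ℝ) • w.2)‖)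
        = α * Real.sqrt ν * (Real.sqrt (T - α * w.1) * ‖u (α * w.1) (0 + (1 : ℝ) • w.2)‖) := by ring
      _ ≤ α * Real.sqrt ν * B := mul_le_mul_of_nonneg_left hu' (by positivity)
      _ = c := by rw [hc]
  have hKx : ∀ x : EuclideanSpace ℝ (Fin 3), ∀ r ∈ Ioo (0 : ℝ) (r₁ / 2),
      cknAEss r ((ν * T, x) : ℝ × EuclideanSpace ℝ (Fin 3)) v + cknE r (ν * T, x) Gv +
        cknC r (ν * T, x) v + cknD r (ν * T, x) (α ^ 2 • stPull α 1 0 0 q) ≤ K := fun x =>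
    hK hsw hGv hr₁pos (hzsub x) ((hCtop x).trans (ENNReal.coe_toNNReal hC₀top).symm.le)
      ((hDtop x).trans (ENNReal.coe_toNNReal hD₀top).symm.le) (hrateV x)
  set κ : ℝ := min 1 (Real.sqrt ν) with hκ
  have hκpos : 0 < κ := lt_min one_pos (Real.sqrt_pos.2 hν)
  have hκ1 : κ ≤ 1 := min_le_left _ _
  have hκν : α * κ ^ 2 ≤ 1 := by
    have h1 : κ ^ 2 ≤ ν := by
      have h := pow_le_pow_left₀ hκpos.le (min_le_right 1 (Real.sqrt ν)) 2
      rwa [Real.sq_sqrt hν.le] at h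
    calc α * κ ^ 2 ≤ α * ν := mul_le_mul_of_nonneg_left h1 hαpos.le
      _ = 1 := hαν
  set lam : ℝ := (2 * Real.sqrt ν + ν / μ) / (ϑ * κ) + 1 with hlam
  have hϑκ : 0 < ϑ * κ := mul_pos hϑ hκpos
  have hlampos : 0 < lam := by rw [hlam]; positivity
  have hprod : ϑ * κ * lam = 2 * Real.sqrt ν + ν / μ + ϑ * κ := by
    have h1 : (2 * Real.sqrt ν + ν / μ) / (ϑ * κ) * (ϑ * κ) = 2 * Real.sqrt ν + ν / μ :=
      div_mul_cancel₀ _ hϑκ.ne'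
    rw [hlam]
    linear_combination h1
  have hlam1 : 2 * Real.sqrt ν < ϑ * κ * lam := by
    rw [hprod]
    have : 0 ≤ ν / μ := by positivity
    linarith
  have hlam2 : ν ≤ μ * (ϑ * κ * lam) := by
    rw [hprod]
    have h1 : μ * (ν / μ) = ν := by field_simp
    have h2 : 0 ≤ μ * (2 * Real.sqrt ν) := by positivity
    have h3 : 0 ≤ μ * (ϑ * κ) := by positivity
    have e : μ * (2 * Real.sqrt ν + ν / μ + ϑ * κ) =
        μ * (2 * Real.sqrt ν) + μ * (ν / μ) + μ * (ϑ * κ) := by ring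
    rw [e]
    linarith
  set t₀ : ℝ := max tI' (T - (r₁ / (2 * (κ * lam))) ^ 2) with ht₀
  have hκlam : 0 < κ * lam := mul_pos hκpos hlampos
  have ht₀T : t₀ < T :=
    max_lt htI'T (by have h := pow_pos (div_pos hr₁pos (mul_pos two_pos hκlam)) 2; linarith)
  refine ⟨ν * η * κ, lam, t₀, by positivity, hlampos, ht₀T, ?_⟩
  intro t ht x hnc
  have hTt : 0 < T - t := by linarith [ht.2]
  have ht0 : 0 ≤ t := htI'0.trans (lt_of_le_of_lt (le_max_left _ _) ht.1).le
  set s : ℝ := Real.sqrt (T - t) with hs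
  have hspos : 0 < s := Real.sqrt_pos.2 hTt
  have hs2 : s ^ 2 = T - t := Real.sq_sqrt hTt.le
  set r : ℝ := lam * s with hr
  have hrpos : 0 < r := mul_pos hlampos hspos
  set ϱ : ℝ := κ * r with hϱ
  have hϱpos : 0 < ϱ := mul_pos hκpos hrpos
  have hϱr : ϱ ≤ r := by rw [hϱ]; exact mul_le_of_le_one_left hrpos.le hκ1
  have hϱr₁ : ϱ < r₁ / 2 := by
    have h1 : T - (r₁ / (2 * (κ * lam))) ^ 2 < t := lt_of_le_of_lt (le_max_right _ _) ht.1
    have h2 : s ^ 2 < (r₁ / (2 * (κ * lam))) ^ 2 := by rw [hs2]; linarith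
    have h3 : s < r₁ / (2 * (κ * lam)) :=
      lt_of_pow_lt_pow_left₀ 2 (div_pos hr₁pos (mul_pos two_pos hκlam)).le h2
    have h4 := mul_lt_mul_of_pos_left h3 hκlam
    rw [show κ * lam * (r₁ / (2 * (κ * lam))) = r₁ / 2 by field_simp] at h4
    calc ϱ = κ * lam * s := by rw [hϱ, hr]; ring
      _ < r₁ / 2 := h4
  have hϱr₁' : ϱ ≤ r₁ := by linarith [hϱr₁, hr₁pos]
  have hϱT : ϱ ^ 2 ≤ ν * T := (pow_le_pow_left₀ hϱpos.le hϱr₁' 2).trans hr₁T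
  set z : ℝ × EuclideanSpace ℝ (Fin 3) := (ν * T, x) with hz
  have hzQ : parabolicCylinder ϱ z ⊆
      ((stPreimage α 1 0 0 Sl : TopologicalSpace.Opens (ℝ × EuclideanSpace ℝ (Fin 3))) :
        Set (ℝ × EuclideanSpace ℝ (Fin 3))) := hcyl _ _ x hϱT le_rfl
  have hA : cknAEss ϱ z v ≤ K :=
    le_trans (le_trans (le_trans le_self_add le_self_add) le_self_add) (hKx x ϱ ⟨hϱpos, hϱr₁⟩)
  have hD : ∀ r' ∈ Ioc (0 : ℝ) ϱ, cknD r' z (α ^ 2 • stPull α 1 0 0 q) ≤ K := fun r' hr' =>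
    le_trans le_add_self (hKx x r' ⟨hr'.1, lt_of_le_of_lt hr'.2 hϱr₁⟩)
  have hE : cknE ϱ z Gv ≤ ENNReal.ofReal η := by
    refine HolderBridge.cknE_le_of_lintegral_le z hϱpos ?_
    have hphys : ∫⁻ w in Ioo (α * (ν * T - ϱ ^ 2)) (α * (ν * T)) ×ˢ ball x ϱ,
        ENNReal.ofReal (frobeniusNormSq (fderiv ℝ (u w.1) w.2)) ≤ ENNReal.ofReal (ν * η * κ * r) := by
      have hlow : T - r ^ 2 ≤ α * (ν * T - ϱ ^ 2) := by
        have e : α * (ν * T - ϱ ^ 2) = T - (α * κ ^ 2) * r ^ 2 := by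
          rw [mul_sub, hανT, hϱ]; ring
        rw [e]
        have : (α * κ ^ 2) * r ^ 2 ≤ 1 * r ^ 2 := mul_le_mul_of_nonneg_right hκν (sq_nonneg _)
        linarith
      have hsubset : Ioo (α * (ν * T - ϱ ^ 2)) (α * (ν * T)) ×ˢ ball x ϱ ⊆
          Ioo (T - r ^ 2) T ×ˢ ball x r :=
        prod_mono (Ioo_subset_Ioo hlow hανT.le) (ball_subset_ball hϱr)
      refine (lintegral_mono_set hsubset).trans ?_
      refine (FiniteDissipationLiouville.Birth.Apex.setLIntegral_prod_le_lintegral_lintegral _ _ _).trans ?_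
      exact (not_le.1 hnc).le
    rw [← hpre ϱ x, hGv_def, setLIntegral_frobeniusNormSq_stRescale hαpos one_pos 0 0 (α * 1)
      (fun t x => fderiv ℝ (u t) x) _]
    simp only [finrank_euclideanSpace_fin, one_pow, mul_one]
    calc ENNReal.ofReal (α ^ 2) * ENNReal.ofReal α⁻¹ *
          ∫⁻ w in Ioo (α * (ν * T - ϱ ^ 2)) (α * (ν * T)) ×ˢ ball x ϱ,
            ENNReal.ofReal (frobeniusNormSq (fderiv ℝ (u w.1) w.2))
        ≤ ENNReal.ofReal (α ^ 2) * ENNReal.ofReal α⁻¹ * ENNReal.ofReal (ν * η * κ * r) :=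
          mul_le_mul' le_rfl hphys
      _ = ENNReal.ofReal (η * ϱ) := by
          rw [← ENNReal.ofReal_mul (sq_nonneg _), ← ENNReal.ofReal_mul (by positivity)]
          congr 1
          have e1 : α ^ 2 * α⁻¹ = α := by
            rw [pow_two, mul_assoc, mul_inv_cancel₀ hαpos.ne', mul_one]
          rw [e1, hϱ]
          calc α * (ν * η * κ * r) = (α * ν) * (η * (κ * r)) := by ring
            _ = η * (κ * r) := by rw [hαν, one_mul]
  have hsmall := Hq _ v _ Gv hsw hGv z ϱ hϱpos hzQ hA hD hE
  set ρ' : ℝ := ϑ * ϱ / 2 with hρ'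
  have hρ'pos : 0 < ρ' := by rw [hρ']; positivity
  set U : Set (ℝ × EuclideanSpace ℝ (Fin 3)) :=
    Ioo (α * (ν * T - ρ' ^ 2)) (α * (ν * T)) ×ˢ ball x ρ' with hU
  have hsmall' : ∀ᵐ w ∂(volume.restrict (stAffine α 1 0 0 ⁻¹' U)),
      ‖u (stAffine α 1 0 0 w).1 (stAffine α 1 0 0 w).2‖ ≤ ν * (1 / (ϑ * ϱ)) := by
    rw [hU, hpre ρ' x]
    filter_upwards [hsmall] with w hw
    rw [stAffine_fst, stAffine_snd]
    have ev : v w.1 w.2 = α • u (0 + α * w.1) (0 + (1 : ℝ) • w.2) := smul_stPull_apply α α 1 0 0 u _ _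
    rw [ev, norm_smul, Real.norm_of_nonneg hαpos.le] at hw
    have h := mul_le_mul_of_nonneg_left hw hν.le
    rwa [← mul_assoc, hνα, one_mul] at h
  have hphys : ∀ᵐ w ∂(volume.restrict U), ‖u w.1 w.2‖ ≤ ν * (1 / (ϑ * ϱ)) :=
    ae_restrict_of_ae_restrict_preimage_stAffine
      (P := fun w : ℝ × EuclideanSpace ℝ (Fin 3) => ‖u w.1 w.2‖ ≤ ν * (1 / (ϑ * ϱ)))
      hαpos one_pos 0 0 hsmall'
  have hUopen : IsOpen U := isOpen_Ioo.prod isOpen_ball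
  have hρ'ϱ : ρ' ≤ ϱ := by
    rw [hρ']
    have : ϑ * ϱ ≤ 1 * ϱ := mul_le_mul_of_nonneg_right hϑ1 hϱpos.le
    linarith
  have hαρ' : α * ρ' ^ 2 ≤ T := by
    have h1 : ρ' ^ 2 ≤ r₁ ^ 2 := pow_le_pow_left₀ hρ'pos.le (hρ'ϱ.trans hϱr₁') 2
    have h2 : α * ρ' ^ 2 ≤ α * r₁ ^ 2 := mul_le_mul_of_nonneg_left h1 hαpos.le
    exact h2.trans hαr₁T
  have hUlow : 0 ≤ α * (ν * T - ρ' ^ 2) := by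
    rw [mul_sub, hανT]; linarith
  have hUsub : U ⊆ Ico 0 T ×ˢ (univ : Set (EuclideanSpace ℝ (Fin 3))) := by
    intro w hw
    rw [hU, mem_prod, mem_Ioo] at hw
    exact ⟨⟨hUlow.trans hw.1.1.le, by rw [← hανT]; exact hw.1.2⟩, mem_univ _⟩
  have hcont : ContinuousOn (uncurry u) U := (SereginSverak2002.continuousOn_uncurry hsol).mono hUsub
  have hpt := norm_le_of_ae_of_continuousOn hUopen hcont hphys
  have htx : ((t, x) : ℝ × EuclideanSpace ℝ (Fin 3)) ∈ U := by
    rw [hU, mem_prod, mem_Ioo]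
    refine ⟨⟨?_, by rw [hανT]; exact ht.2⟩, mem_ball_self hρ'pos⟩
    have h1 : 4 * ν < (ϑ * κ * lam) ^ 2 := by
      have h0 : 0 ≤ 2 * Real.sqrt ν := by positivity
      have h4 : (2 * Real.sqrt ν) ^ 2 = 4 * ν := by rw [mul_pow, Real.sq_sqrt hν.le]; norm_num
      rw [← h4]
      exact pow_lt_pow_left₀ hlam1 h0 two_ne_zero
    have h2 : ρ' = ϑ * κ * lam * s / 2 := by rw [hρ', hϱ, hr]; ring
    have h3 : α * (ν * T - ρ' ^ 2) = T - α * (ϑ * κ * lam) ^ 2 / 4 * s ^ 2 := by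
      rw [mul_sub, hανT, h2]; ring
    rw [h3, hs2]
    have h5 : 1 < α * (ϑ * κ * lam) ^ 2 / 4 := by
      have h6 := mul_lt_mul_of_pos_left h1 hαpos
      have e : α * (4 * ν) = 4 := by rw [mul_left_comm, hαν, mul_one]
      rw [e] at h6
      linarith
    have h7 := mul_lt_mul_of_pos_right h5 hTt
    linarith
  have hfin := hpt (t, x) htx
  dsimp only at hfin
  refine hfin.trans ?_
  rw [mul_one_div, div_le_div_iff₀ (by positivity) hspos]
  calc ν * s ≤ μ * (ϑ * κ * lam) * s := mul_le_mul_of_nonneg_right hlam2 hspos.le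
    _ = μ * (ϑ * ϱ) := by rw [hϱ, hr]; ring

end CountQuarterLaw

end Summit.NavierStokesRegularity.NavierStokesRegularity.Theorems

end
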